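import Literature.NumberTheory.LFunctions.ConreyIwaniec2002AFEUnfolding
import Literature.NumberTheory.LFunctions.ClassGroupSieveDensity
import Literature.Analysis.Complex.VerticalLineShiftPoles
import HarnessLib

/-!
# Conrey–Iwaniec (2002), Proposition 7.1 — part II: the contour shift and the exact identity

B. Conrey, H. Iwaniec, *Spacing of zeros of Hecke L-functions and the class number problem*,
Acta Arith. 103 (2002), §7, Proposition 7.1 (7.12) [held text `paper:arxiv-math_0111012`, p0017]:
"`L(s,ψ) = Σ λ(n)n^{−s}V_s(n/Q) + X(s) Σ λ(n)n^{s−1}V_{1−s}(n/Q) + (residual)`", proved by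
integrating `I(s) = (1/2πi)∫_{(1)} Λ(s+u)G(u)u^{−1}du`, "moving the integration to the line
`Re u = −1` and then applying the functional equation (7.7)". Everything here is PROVED (no
definitions, no named facts); the objects are those of `ConreyIwaniec2002AFEDefs.lean`.

THE PROOF, as typed. With the tree's ENTIRE completion `ξ(w,ψ) = w(w−1)γ_K(w)L(w,ψ)`
(`classXi`, `ClassGroupXi.lean`) put `F(u) = ξ(s+u,ψ)/((s+u)(s+u−1)) · G(u)/u`, `G = e^{u²}`:
meromorphic with (at most) the three simple poles `u = 0, 1−s, −s`, Gaussian-small on horizontal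
segments (`‖ξ(w)‖ ≤ Ce^{‖w‖^{15/8}}`, `exists_norm_classXi_le`, against `|G(c+iv)| = e^{c²−v²}`).
* `integral_afeF_lineOne_sub_lineNegOne` (`Re s = ½`): the residue theorem of the tree
  (`Literature.Analysis.Complex.integral_vertical_sub_eq_sum_of_poles`) between `Re u = ±1`:
  `∫F(1+iv) − ∫F(−1+iv) = 2π(ξ(s)/(s(s−1)) + ξ(1)G(1−s)/(1−s) + ξ(0)G(s)/s)`;
* `integral_afeF_lineNegOne`: by `v ↦ −v` and `ξ(1−w,ψ) = W(ψ)ξ(w,ψ⁻¹)` (`classXi_one_sub`,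
  `W(ψ) = ψ([𝔡_K])`), the left line is `−W(ψ)` times the line-`1` integral of `(ψ⁻¹, 1−s)`;
* part I (`integral_lineOne`) evaluates both line-`1` integrals: `2πγ_K(s)A_ψ(s)` and
  `2πγ_K(1−s)A_{ψ⁻¹}(1−s)`; `γ_K(1−s) = X(s)γ_K(s)` (`afeX`); the residues: `ξ(1,ψ) = ξ(0,ψ) = 0`
  for `ψ ≠ 1`, and `ξ(1,1) = ξ(0,1) = γ_K(1)κ_K = 2Qκ_K` (`classTwistedZeta₁_one_one_eq_residue`),
  giving exactly the typed two-pole residual `afeR` (NOT the printed one-term display of (7.12),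
  which omits the `u = −s` residue — see the docstring of `afeR`);
* `classGroupLFunction_eq_afe` (`Re s = ½`, dual sum explicit), `classGroupLFunction_eq_afe_conj`
  (`s = ½+it`: the dual sum is `conj A_ψ(s)` by `afeA_inv_conj`), and
  `classGroupLFunction_eq_afe_all` — the registered shape of stub S1 `stub_afe` of the line
  `prop81-afe-plancherel` (its hypotheses `4 < q`, `Odd q`, `t ≠ 0` are not needed).

«The programme SEARCHES and TYPES; no claim about Landau–Siegel zeros, Theorems 1–2 of
arXiv:2211.02515 or a repaired Margin232 until a kernel theorem says so.»

## References
* [ConreyIwaniec2002] B. Conrey, H. Iwaniec, Acta Arith. 103 (2002) 259–312, arXiv:math/0111012,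
  §7 (7.6)–(7.14), Proposition 7.1 (7.12).
* [NeukirchANT1999] J. Neukirch, *Algebraic Number Theory*, Springer 1999, Ch. VII (8.5)–(8.6).
-/

noncomputable section

open scoped NumberField ComplexConjugate
open Complex MeasureTheory Filter Topology Set

namespace Literature.NumberTheory.LFunctions

namespace ConreyIwaniec2002

open NumberField Literature.NumberTheory.LFunctions.NumberField

variable {K : Type} [Field K] [NumberField K]

/-! ## The integrand `F(u) = ξ(s+u,ψ)/((s+u)(s+u−1)) · G(u)/u` of the contour shift -/

/-- `F` is differentiable away from `u = 0`, `u = −s`, `u = 1 − s` (`ξ(·,ψ)` is entire).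
[cite: ConreyIwaniec2002, Proposition 7.1 (proof)] -/
theorem differentiableAt_afeF (ψ : ClassGroup (𝓞 K) →* ℂˣ) (s : ℂ) {u : ℂ} (hu0 : u ≠ 0)
    (hus : s + u ≠ 0) (hus1 : s + u ≠ 1) :
    DifferentiableAt ℂ (fun u : ℂ ↦ classXi K ψ (s + u) / ((s + u) * (s + u - 1)) * afeG u / u) u := by
  have h1 : DifferentiableAt ℂ (fun u : ℂ ↦ classXi K ψ (s + u)) u :=
    ((differentiable_classXi ψ) (s + u)).comp u ((differentiableAt_const s).add differentiableAt_id)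
  have h2 : DifferentiableAt ℂ (fun u : ℂ ↦ (s + u) * (s + u - 1)) u := by fun_prop
  have h3 : (s + u) * (s + u - 1) ≠ 0 := mul_ne_zero hus (sub_ne_zero.2 hus1)
  exact (((h1.div h2 h3).mul (differentiable_afeG u)).div differentiableAt_id hu0)

/-- `v ↦ F(c + iv)` is continuous on any vertical line missing the three poles. [folklore] -/
private theorem continuous_afeF_line (ψ : ClassGroup (𝓞 K) →* ℂˣ) (s : ℂ) {c : ℝ} (hc0 : c ≠ 0)
    (hc1 : s.re + c ≠ 0) (hc2 : s.re + c ≠ 1) :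
    Continuous fun v : ℝ ↦ classXi K ψ (s + (c + v * I)) / ((s + (c + v * I)) * (s + (c + v * I) - 1)) *
      afeG (c + v * I) / (c + v * I) := by
  refine continuous_iff_continuousAt.2 fun v ↦ ?_
  have hu0 : (c : ℂ) + v * I ≠ 0 := fun h ↦ by
    have := congrArg Complex.re h; simp at this; exact hc0 this
  have hus : s + (c + v * I) ≠ 0 := fun h ↦ by
    have := congrArg Complex.re h; simp at this; exact hc1 this
  have hus1 : s + (c + v * I) ≠ 1 := fun h ↦ by
    have := congrArg Complex.re h; simp at this; exact hc2 this
  have hd := differentiableAt_afeF ψ s hu0 hus hus1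
  have hc : Continuous fun v : ℝ ↦ (c : ℂ) + v * I := by fun_prop
  exact ContinuousAt.comp (f := fun v : ℝ ↦ (c : ℂ) + v * I) hd.continuousAt hc.continuousAt

/-- **Gaussian majorant of `F` on the strip `|Re u| ≤ 1`** away from the poles: there is `M` with
`‖F(c+iv)‖ ≤ M e^{−v²/2}` whenever `|c| ≤ 1` and `|s+u|, |s+u−1|, |u| ≥ 1/2` — from the growth
`‖ξ(w,ψ)‖ ≤ C e^{‖w‖^{15/8}}` (`exists_norm_classXi_le`) against `|G(c+iv)| = e^{c²−v²}`.
[cite: ConreyIwaniec2002, Proposition 7.1 (proof)] -/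
theorem exists_afeF_majorant (ψ : ClassGroup (𝓞 K) →* ℂˣ) (s : ℂ) :
    ∃ M : ℝ, 0 < M ∧ ∀ c v : ℝ, |c| ≤ 1 → 1 / 2 ≤ ‖s + (c + v * I)‖ → 1 / 2 ≤ ‖s + (c + v * I) - 1‖ →
      1 / 2 ≤ ‖(c : ℂ) + v * I‖ →
        ‖classXi K ψ (s + (c + v * I)) / ((s + (c + v * I)) * (s + (c + v * I) - 1)) *
            afeG (c + v * I) / (c + v * I)‖ ≤ M * Real.exp (-(1 / 2) * v ^ 2) := by
  obtain ⟨C, hC0, hC⟩ := exists_norm_classXi_le (K := K) ψ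
  obtain ⟨A, hA0, hA⟩ := Stark1974.exists_mul_add_rpow_le (μ := 15 / 8) (μ' := 2) (c := 2)
    (a := ‖s‖ + 1) (by norm_num) (by norm_num) (by norm_num) (by positivity)
  refine ⟨8 * (C + 1) * Real.exp 1 * Real.exp (A / 2), by positivity, fun c v hc h1 h2 h3 ↦ ?_⟩
  have hG : ‖afeG (c + v * I)‖ = Real.exp (c ^ 2 - v ^ 2) := norm_afeG c v
  have hsu : ‖s + (c + v * I)‖ ≤ ‖s‖ + 1 + |v| := by
    calc ‖s + (c + v * I)‖ ≤ ‖s‖ + ‖(c : ℂ) + v * I‖ := norm_add_le _ _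
      _ ≤ ‖s‖ + (‖(c : ℂ)‖ + ‖(v : ℂ) * I‖) := by gcongr; exact norm_add_le _ _
      _ = ‖s‖ + (|c| + |v|) := by simp
      _ ≤ ‖s‖ + 1 + |v| := by linarith
  have hrpow : ‖s + (c + v * I)‖ ^ (15 / 8 : ℝ) ≤ (‖s‖ + 1 + |v|) ^ (15 / 8 : ℝ) :=
    Real.rpow_le_rpow (norm_nonneg _) hsu (by norm_num)
  have hA' := hA |v| (abs_nonneg v)
  rw [Real.rpow_two, sq_abs] at hA'
  have hc2 : c ^ 2 ≤ 1 := by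
    have : |c| ^ 2 ≤ 1 ^ 2 := pow_le_pow_left₀ (abs_nonneg c) hc 2
    rw [sq_abs, one_pow] at this; exact this
  have hξ : ‖classXi K ψ (s + (c + v * I))‖ ≤ C * Real.exp ((‖s‖ + 1 + |v|) ^ (15 / 8 : ℝ)) :=
    (hC _).trans (by gcongr)
  have hden : (1 / 2 : ℝ) * (1 / 2) ≤ ‖s + (c + v * I)‖ * ‖s + (c + v * I) - 1‖ :=
    mul_le_mul h1 h2 (by norm_num) (norm_nonneg _)
  have step1 : ‖classXi K ψ (s + (c + v * I))‖ / (‖s + (c + v * I)‖ * ‖s + (c + v * I) - 1‖) ≤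
      C * Real.exp ((‖s‖ + 1 + |v|) ^ (15 / 8 : ℝ)) / (1 / 2 * (1 / 2)) := by
    calc _ ≤ ‖classXi K ψ (s + (c + v * I))‖ / (1 / 2 * (1 / 2)) :=
          div_le_div_of_nonneg_left (norm_nonneg _) (by norm_num) hden
      _ ≤ _ := by gcongr
  have step2 : ‖afeG (c + v * I)‖ / ‖(c : ℂ) + v * I‖ ≤ Real.exp (c ^ 2 - v ^ 2) / (1 / 2) := by
    rw [hG]; exact div_le_div_of_nonneg_left (Real.exp_pos _).le (by norm_num) h3
  have hexp : Real.exp ((‖s‖ + 1 + |v|) ^ (15 / 8 : ℝ)) * Real.exp (c ^ 2 - v ^ 2) ≤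
      Real.exp 1 * Real.exp (A / 2) * Real.exp (-(1 / 2) * v ^ 2) := by
    rw [← Real.exp_add, ← Real.exp_add, ← Real.exp_add]
    exact Real.exp_le_exp.mpr (by nlinarith)
  rw [norm_div, norm_mul, norm_div, norm_mul, mul_div_assoc]
  calc ‖classXi K ψ (s + (c + v * I))‖ / (‖s + (c + v * I)‖ * ‖s + (c + v * I) - 1‖) *
        (‖afeG (c + v * I)‖ / ‖(c : ℂ) + v * I‖)
      ≤ C * Real.exp ((‖s‖ + 1 + |v|) ^ (15 / 8 : ℝ)) / (1 / 2 * (1 / 2)) *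
        (Real.exp (c ^ 2 - v ^ 2) / (1 / 2)) :=
        mul_le_mul step1 step2 (by positivity) (by positivity)
    _ = 8 * C * (Real.exp ((‖s‖ + 1 + |v|) ^ (15 / 8 : ℝ)) * Real.exp (c ^ 2 - v ^ 2)) := by ring
    _ ≤ 8 * C * (Real.exp 1 * Real.exp (A / 2) * Real.exp (-(1 / 2) * v ^ 2)) := by gcongr
    _ ≤ 8 * (C + 1) * Real.exp 1 * Real.exp (A / 2) * Real.exp (-(1 / 2) * v ^ 2) := by
        have : 0 ≤ Real.exp 1 * Real.exp (A / 2) * Real.exp (-(1 / 2) * v ^ 2) := by positivity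
        nlinarith

/-- `F` is integrable along `Re u = 1` and along `Re u = −1` (`Re s = 1/2`). [folklore] -/
private theorem integrable_afeF_line (ψ : ClassGroup (𝓞 K) →* ℂˣ) {s : ℂ} (hs : s.re = 1 / 2) {c : ℝ}
    (hc : c = 1 ∨ c = -1) :
    Integrable fun v : ℝ ↦ classXi K ψ (s + (c + v * I)) / ((s + (c + v * I)) * (s + (c + v * I) - 1)) *
      afeG (c + v * I) / (c + v * I) := by
  obtain ⟨M, hM, hmaj⟩ := exists_afeF_majorant (K := K) ψ s
  have hcont : Continuous fun v : ℝ ↦ classXi K ψ (s + (c + v * I)) /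
      ((s + (c + v * I)) * (s + (c + v * I) - 1)) * afeG (c + v * I) / (c + v * I) := by
    refine continuous_afeF_line ψ s ?_ ?_ ?_ <;> (rcases hc with rfl | rfl <;> norm_num [hs])
  have hg : Integrable fun v : ℝ ↦ M * Real.exp (-(1 / 2) * v ^ 2) :=
    (integrable_exp_neg_mul_sq (by norm_num : (0 : ℝ) < 1 / 2)).const_mul M
  refine hg.mono' hcont.aestronglyMeasurable (Eventually.of_forall fun v ↦ hmaj c v ?_ ?_ ?_ ?_)
  · rcases hc with rfl | rfl <;> simp
  · refine le_trans ?_ (Complex.abs_re_le_norm _)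
    rcases hc with rfl | rfl <;> norm_num [hs]
  · refine le_trans ?_ (Complex.abs_re_le_norm _)
    rcases hc with rfl | rfl <;> norm_num [hs]
  · refine le_trans ?_ (Complex.abs_re_le_norm _)
    rcases hc with rfl | rfl <;> norm_num

/-- **Decay on the horizontal sides**: `sup_{|c| ≤ 1} ‖F(c + iT)‖ → 0` as `|T| → ∞`. [folklore] -/
private theorem afeF_decay (ψ : ClassGroup (𝓞 K) →* ℂˣ) (s : ℂ) :
    ∀ ε : ℝ, 0 < ε → ∃ T₀ : ℝ, ∀ T : ℝ, T₀ ≤ |T| → ∀ c ∈ Icc (-1 : ℝ) 1,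
      ‖classXi K ψ (s + (c + T * I)) / ((s + (c + T * I)) * (s + (c + T * I) - 1)) *
          afeG (c + T * I) / (c + T * I)‖ ≤ ε := by
  obtain ⟨M, hM, hmaj⟩ := exists_afeF_majorant (K := K) ψ s
  refine Literature.Analysis.Complex.decay_of_bound
    (F := fun u : ℂ ↦ classXi K ψ (s + u) / ((s + u) * (s + u - 1)) * afeG u / u)
    (g := fun T ↦ M * Real.exp (-(1 / 2) * T ^ 2)) (T₀ := ‖s‖ + 1) ?_ ?_
  · intro T hT c hc
    have hc' : |c| ≤ 1 := abs_le.2 ⟨hc.1, hc.2⟩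
    have hT1 : 1 ≤ |T| := le_trans (by linarith [norm_nonneg s]) hT
    have him : 1 ≤ |s.im + T| := by
      have h1 : |T| ≤ |s.im + T| + |s.im| := by
        have := abs_add_le (s.im + T) (-s.im); simp at this; linarith [abs_neg s.im]
      have h2 : |s.im| ≤ ‖s‖ := Complex.abs_im_le_norm s
      linarith
    have e1 : 1 / 2 ≤ ‖s + (c + T * I)‖ := by
      refine le_trans ?_ (Complex.abs_im_le_norm _)
      simp; linarith
    have e2 : 1 / 2 ≤ ‖s + (c + T * I) - 1‖ := by
      refine le_trans ?_ (Complex.abs_im_le_norm _)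
      simp; linarith
    have e3 : 1 / 2 ≤ ‖(c : ℂ) + T * I‖ := by
      refine le_trans ?_ (Complex.abs_im_le_norm _)
      simp; linarith
    have := hmaj c T hc' e1 e2 e3
    simpa [sq_abs] using this
  · have h1 : Tendsto (fun T : ℝ ↦ -(1 / 2) * T ^ 2) atTop atBot := by
      have h0 : Tendsto (fun T : ℝ ↦ (1 / 2) * T ^ 2) atTop atTop :=
        (tendsto_pow_atTop two_ne_zero).const_mul_atTop (by norm_num)
      refine (tendsto_neg_atTop_atBot.comp h0).congr' (Eventually.of_forall fun T ↦ ?_)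
      simp only [Function.comp_apply]
      ring
    have h2 := (Real.tendsto_exp_atBot.comp h1).const_mul M
    simpa using h2

/-- **Shifting `Re u = 1 → Re u = −1` across the simple poles `u = 0, 1−s, −s`** (`Re s = 1/2`):
`∫ F(1+iv) dv − ∫ F(−1+iv) dv = 2π (ξ(s)/(s(s−1)) + ξ(1) G(1−s)/(1−s) + ξ(0) G(s)/s)`, the three
residues of `F(u) = ξ(s+u)/((s+u)(s+u−1)) G(u)/u` (for `ψ ≠ 1` the last two vanish, `ξ(1) = ξ(0) = 0`).
[cite: ConreyIwaniec2002, Proposition 7.1 (proof: "moving the integration … to Re u = −1")] -/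
theorem integral_afeF_lineOne_sub_lineNegOne (ψ : ClassGroup (𝓞 K) →* ℂˣ) {s : ℂ} (hs : s.re = 1 / 2) :
    (∫ v : ℝ, classXi K ψ (s + (1 + v * I)) / ((s + (1 + v * I)) * (s + (1 + v * I) - 1)) *
        afeG (1 + v * I) / (1 + v * I)) -
      ∫ v : ℝ, classXi K ψ (s + (-1 + v * I)) / ((s + (-1 + v * I)) * (s + (-1 + v * I) - 1)) *
        afeG (-1 + v * I) / (-1 + v * I) =
      2 * Real.pi * (classXi K ψ s / (s * (s - 1)) + classXi K ψ 1 * afeG (1 - s) / (1 - s) +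
        classXi K ψ 0 * afeG s / s) := by
  classical
  have hs0 : s ≠ 0 := fun h ↦ by rw [h, Complex.zero_re] at hs; norm_num at hs
  have hs1 : s ≠ 1 := fun h ↦ by rw [h, Complex.one_re] at hs; norm_num at hs
  have h1s : (1 : ℂ) - s ≠ 0 := sub_ne_zero.2 (Ne.symm hs1)
  have hns : -s ≠ 0 := neg_ne_zero.2 hs0
  have hp01 : (0 : ℂ) ≠ 1 - s := h1s.symm
  have hp02 : (0 : ℂ) ≠ -s := hns.symm
  have hp12 : (1 : ℂ) - s ≠ -s := fun h ↦ by
    have := congrArg Complex.re h; simp [hs] at this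
  set F : ℂ → ℂ := fun u ↦ classXi K ψ (s + u) / ((s + u) * (s + u - 1)) * afeG u / u with hF
  set φ : ℂ → ℂ → ℂ := fun p z ↦
    if p = 0 then classXi K ψ (s + z) / ((s + z) * (s + z - 1)) * afeG z
    else if p = 1 - s then classXi K ψ (s + z) / (s + z) * afeG z / z
    else classXi K ψ (s + z) / (s + z - 1) * afeG z / z with hφ
  have hξd : ∀ z : ℂ, DifferentiableAt ℂ (fun z : ℂ ↦ classXi K ψ (s + z)) z := fun z ↦
    ((differentiable_classXi ψ) (s + z)).comp z ((differentiableAt_const s).add differentiableAt_id)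
  have hφ0f : φ 0 = fun z ↦ classXi K ψ (s + z) / ((s + z) * (s + z - 1)) * afeG z := by
    funext z; rw [hφ]; beta_reduce; rw [if_pos rfl]
  have hφ1f : φ (1 - s) = fun z ↦ classXi K ψ (s + z) / (s + z) * afeG z / z := by
    funext z; rw [hφ]; beta_reduce; rw [if_neg h1s, if_pos rfl]
  have hφ2f : φ (-s) = fun z ↦ classXi K ψ (s + z) / (s + z - 1) * afeG z / z := by
    funext z; rw [hφ]; beta_reduce; rw [if_neg hns, if_neg hp12.symm]
  -- the residue theorem
  have key := Literature.Analysis.Complex.integral_vertical_sub_eq_sum_of_poles (F := F)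
    (σ₁ := -1) (κ := 1) (by norm_num) ({0, 1 - s, -s} : Finset ℂ) (fun _ ↦ 0) φ Set.univ
    isOpen_univ (Set.subset_univ _) ?hS ?hFd ?hpole ?hint1 ?hint2 ?hdecay
  case hS =>
    intro p hp
    simp only [Finset.mem_insert, Finset.mem_singleton] at hp
    rcases hp with rfl | rfl | rfl
    · simp
    · simp [hs]; norm_num
    · simp [hs]; norm_num
  case hFd =>
    intro z hz
    simp only [Set.mem_sdiff, Set.mem_univ, true_and, Finset.coe_insert, Finset.coe_singleton,
      Set.mem_insert_iff, Set.mem_singleton_iff, not_or] at hz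
    obtain ⟨hz0, hz1, hz2⟩ := hz
    refine (differentiableAt_afeF ψ s hz0 ?_ ?_).differentiableWithinAt
    · intro h; exact hz2 (by linear_combination h)
    · intro h; exact hz1 (by linear_combination h)
  case hpole =>
    intro p hp
    simp only [Finset.mem_insert, Finset.mem_singleton] at hp
    rcases hp with rfl | rfl | rfl
    · -- the pole `u = 0`
      refine ⟨{z : ℂ | s + z ≠ 0 ∧ s + z ≠ 1}, ?_, ?_, ?_⟩
      · refine IsOpen.mem_nhds ?_ ?_
        · exact (isOpen_ne_fun (by fun_prop) (by fun_prop)).inter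
            (isOpen_ne_fun (by fun_prop) (by fun_prop))
        · simp only [Set.mem_setOf_eq, add_zero]; exact ⟨hs0, hs1⟩
      · intro z hz
        simp only [Set.mem_setOf_eq] at hz
        have h3 : (s + z) * (s + z - 1) ≠ 0 := mul_ne_zero hz.1 (sub_ne_zero.2 hz.2)
        have hd1 : DifferentiableAt ℂ (fun z ↦ classXi K ψ (s + z) / ((s + z) * (s + z - 1))) z :=
          (hξd z).div (by fun_prop) h3
        have hd2 : DifferentiableAt ℂ
            (fun z ↦ classXi K ψ (s + z) / ((s + z) * (s + z - 1)) * afeG z) z :=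
          hd1.mul (differentiable_afeG z)
        rw [hφ0f]
        exact hd2.differentiableWithinAt
      · intro z _ _
        rw [hφ0f, hF]
        simp only [sub_zero, zero_add, pow_one]
    · -- the pole `u = 1 − s`
      refine ⟨{z : ℂ | z ≠ 0 ∧ s + z ≠ 0}, ?_, ?_, ?_⟩
      · refine IsOpen.mem_nhds ?_ ?_
        · exact (isOpen_ne_fun (by fun_prop) (by fun_prop)).inter
            (isOpen_ne_fun (by fun_prop) (by fun_prop))
        · simp only [Set.mem_setOf_eq, add_sub_cancel]; exact ⟨h1s, one_ne_zero⟩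
      · intro z hz
        simp only [Set.mem_setOf_eq] at hz
        have hd1 : DifferentiableAt ℂ (fun z ↦ classXi K ψ (s + z) / (s + z)) z :=
          (hξd z).div (by fun_prop) hz.2
        have hd2 : DifferentiableAt ℂ (fun z ↦ classXi K ψ (s + z) / (s + z) * afeG z) z :=
          hd1.mul (differentiable_afeG z)
        have hd3 : DifferentiableAt ℂ (fun z ↦ classXi K ψ (s + z) / (s + z) * afeG z / z) z :=
          hd2.div differentiableAt_id hz.1
        rw [hφ1f]
        exact hd3.differentiableWithinAt
      · intro z hz hzp
        simp only [Set.mem_setOf_eq] at hz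
        have hz0 : z ≠ 0 := hz.1
        have hsz : s + z ≠ 0 := hz.2
        have hzp' : z - (1 - s) ≠ 0 := sub_ne_zero.2 hzp
        have hsz1 : s + z - 1 ≠ 0 := by rw [show s + z - 1 = z - (1 - s) by ring]; exact hzp'
        rw [hφ1f, hF]
        simp only [zero_add, pow_one]
        field_simp
        ring
    · -- the pole `u = −s`
      refine ⟨{z : ℂ | z ≠ 0 ∧ s + z ≠ 1}, ?_, ?_, ?_⟩
      · refine IsOpen.mem_nhds ?_ ?_
        · exact (isOpen_ne_fun (by fun_prop) (by fun_prop)).inter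
            (isOpen_ne_fun (by fun_prop) (by fun_prop))
        · simp only [Set.mem_setOf_eq, add_neg_cancel]; exact ⟨hns, zero_ne_one⟩
      · intro z hz
        simp only [Set.mem_setOf_eq] at hz
        have hsz1 : s + z - 1 ≠ 0 := sub_ne_zero.2 hz.2
        have hd1 : DifferentiableAt ℂ (fun z ↦ classXi K ψ (s + z) / (s + z - 1)) z :=
          (hξd z).div (by fun_prop) hsz1
        have hd2 : DifferentiableAt ℂ (fun z ↦ classXi K ψ (s + z) / (s + z - 1) * afeG z) z :=
          hd1.mul (differentiable_afeG z)
        have hd3 : DifferentiableAt ℂ (fun z ↦ classXi K ψ (s + z) / (s + z - 1) * afeG z / z) z :=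
          hd2.div differentiableAt_id hz.1
        rw [hφ2f]
        exact hd3.differentiableWithinAt
      · intro z hz hzp
        simp only [Set.mem_setOf_eq] at hz
        have hz0 : z ≠ 0 := hz.1
        have hsz1 : s + z - 1 ≠ 0 := sub_ne_zero.2 hz.2
        have hzp' : z - -s ≠ 0 := sub_ne_zero.2 hzp
        have hsz : s + z ≠ 0 := by rw [show s + z = z - -s by ring]; exact hzp'
        rw [hφ2f, hF]
        simp only [zero_add, pow_one]
        field_simp
        ring
  case hint1 =>
    have := integrable_afeF_line (K := K) ψ hs (c := 1) (Or.inl rfl)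
    simpa [hF] using this
  case hint2 =>
    have := integrable_afeF_line (K := K) ψ hs (c := -1) (Or.inr rfl)
    simpa [hF] using this
  case hdecay =>
    intro ε hε
    obtain ⟨T₀, hT₀⟩ := afeF_decay (K := K) ψ s ε hε
    exact ⟨T₀, fun T hT c hc ↦ by simpa [hF] using hT₀ T hT c hc⟩
  -- evaluate the residues
  have hsum : ∑ p ∈ ({0, 1 - s, -s} : Finset ℂ), iteratedDeriv ((fun _ ↦ 0) p) (φ p) p /
      (((fun _ : ℂ ↦ 0) p).factorial : ℂ) = φ 0 0 + φ (1 - s) (1 - s) + φ (-s) (-s) := by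
    rw [Finset.sum_insert (by simp [hp01, hp02]), Finset.sum_pair hp12]
    simp [iteratedDeriv_zero, add_assoc]
  have hφ0 : φ 0 0 = classXi K ψ s / (s * (s - 1)) := by
    rw [hφ0f]; simp only [add_zero, afeG_zero, mul_one]
  have hφ1 : φ (1 - s) (1 - s) = classXi K ψ 1 * afeG (1 - s) / (1 - s) := by
    rw [hφ1f]; simp only [add_sub_cancel, div_one]
  have hφ2 : φ (-s) (-s) = classXi K ψ 0 * afeG s / s := by
    rw [hφ2f]; simp only [add_neg_cancel, zero_sub, afeG_neg]
    field_simp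
  rw [hsum, hφ0, hφ1, hφ2] at key
  simpa [hF] using key


/-! ## The line `Re u = −1` is the dual integral (functional equation `ξ(1−w,ψ) = W(ψ)ξ(w,ψ⁻¹)`) -/

/-- **The left line is `−W(ψ)` times the line-`1` integral of the dual data** `(ψ⁻¹, 1 − s)`:
reflect `v ↦ −v` (`−1 − iv = −(1+iv)`), use `ξ(s−u,ψ) = W(ψ)ξ(1−s+u,ψ⁻¹)` (`classXi_one_sub`),
`(s−u)(s−u−1) = (1−s+u)(1−s+u−1)` and `G(−u) = G(u)`.
[cite: ConreyIwaniec2002, Proposition 7.1 (proof: "applying the functional equation (7.7)")] -/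
theorem integral_afeF_lineNegOne (ψ : ClassGroup (𝓞 K) →* ℂˣ) (s : ℂ) :
    ∫ v : ℝ, classXi K ψ (s + (-1 + v * I)) / ((s + (-1 + v * I)) * (s + (-1 + v * I) - 1)) *
        afeG (-1 + v * I) / (-1 + v * I) =
      -(classRootNumber K ψ *
        ∫ v : ℝ, classXi K ψ⁻¹ ((1 - s) + (1 + v * I)) /
            (((1 - s) + (1 + v * I)) * ((1 - s) + (1 + v * I) - 1)) * afeG (1 + v * I) / (1 + v * I)) := by
  rw [← integral_const_mul, ← integral_neg]
  have h := integral_neg_eq_self (μ := volume) (fun v : ℝ ↦ classXi K ψ (s + (-1 + v * I)) /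
    ((s + (-1 + v * I)) * (s + (-1 + v * I) - 1)) * afeG (-1 + v * I) / (-1 + v * I))
  rw [← h]
  refine integral_congr_ae (Eventually.of_forall fun v ↦ ?_)
  simp only [Complex.ofReal_neg]
  have e1 : s + (-1 + -(v : ℂ) * I) = 1 - ((1 - s) + (1 + v * I)) := by ring
  have e2 : (-1 + -(v : ℂ) * I) = -(1 + v * I) := by ring
  rw [e1, classXi_one_sub, e2, afeG_neg, div_neg]
  ring

/-! ## Assembly: Proposition 7.1 -/

/-- The residue value `ξ(1,1) = γ_K(1) κ_K` (`Z₁(1) = κ_K`, the analytic class number formula).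
[cite: NeukirchANT1999, Ch. VII (5.11)] -/
theorem classXi_one_one : classXi K 1 1 = dedekindGammaFactor K 1 * (NumberField.dedekindZeta_residue K : ℂ) := by
  rw [classXi_eq_of_re_pos 1 (by simp), classXiG]
  have : (fun C : ClassGroup (𝓞 K) ↦ (((1 : ClassGroup (𝓞 K) →* ℂˣ) C : ℂˣ) : ℂ)) = fun _ ↦ (1 : ℂ) := by
    funext C; simp
  rw [this, classTwistedZeta₁_one_one_eq_residue]
  ring

/-- `ξ(0, ψ) = W(ψ) ξ(1, ψ⁻¹)`. [cite: NeukirchANT1999, Ch. VII (8.6)] -/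
theorem classXi_zero (ψ : ClassGroup (𝓞 K) →* ℂˣ) :
    classXi K ψ 0 = classRootNumber K ψ * classXi K ψ⁻¹ 1 := by
  have := classXi_one_sub (K := K) ψ 1
  rwa [sub_self] at this

/-- For `ψ ≠ 1` both extra residues vanish: `ξ(1,ψ) = ξ(0,ψ) = 0`. [folklore] -/
private theorem classXi_one_and_zero_of_ne_one {ψ : ClassGroup (𝓞 K) →* ℂˣ} (hψ : ψ ≠ 1) :
    classXi K ψ 1 = 0 ∧ classXi K ψ 0 = 0 := by
  have hψ' : ψ⁻¹ ≠ 1 := fun h ↦ hψ (MonoidHom.ext fun C ↦ by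
    have := DFunLike.congr_fun h C
    simpa using this)
  exact ⟨classXi_one hψ, by rw [classXi_zero, classXi_one hψ', mul_zero]⟩

/-- **`γ_K(1−s) = X(s) γ_K(s)`**: `2Q^{1−s}Γ(1−s) = Q^{1−2s}Γ(1−s)Γ(s)^{−1} · 2Q^sΓ(s)`.
[cite: ConreyIwaniec2002, Proposition 7.1 (7.13)] -/
theorem dedekindGammaFactor_one_sub_eq_afeX_mul {q : ℕ} (h2 : Module.finrank ℚ K = 2)
    (hdisc : NumberField.discr K = -(q : ℤ)) {s : ℂ} (hΓ : Complex.Gamma s ≠ 0) :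
    dedekindGammaFactor K (1 - s) = afeX q s * dedekindGammaFactor K s := by
  have hq : 0 < q := by
    rcases Nat.eq_zero_or_pos q with h | h
    · exfalso; exact NumberField.discr_ne_zero K (by rw [hdisc, h]; simp)
    · exact h
  have hQ0 : (condQ q : ℂ) ≠ 0 := by exact_mod_cast (condQ_pos hq).ne'
  rw [dedekindGammaFactor_eq_condQ K h2 hdisc, dedekindGammaFactor_eq_condQ K h2 hdisc, afeX]
  have : (condQ q : ℂ) ^ (1 - s) = (condQ q : ℂ) ^ (1 - 2 * s) * (condQ q : ℂ) ^ s := by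
    rw [← Complex.cpow_add _ _ hQ0]; ring_nf
  rw [this]
  field_simp

/-- **The residual**: `ξ(1,ψ)G(1−s)/(1−s) + ξ(0,ψ)G(s)/s = −R(s)·γ_K(s)` with the typed two-pole
residual `R = afeR` (`ψ = 1`: `ξ(1,1) = ξ(0,1) = γ_K(1)κ_K = 2Qκ_K`; `ψ ≠ 1`: both sides `0`).
[cite: ConreyIwaniec2002, Proposition 7.1 (7.12)] -/
theorem residues_eq_neg_afeR_mul {q : ℕ} (h2 : Module.finrank ℚ K = 2)
    (hdisc : NumberField.discr K = -(q : ℤ)) (ψ : ClassGroup (𝓞 K) →* ℂˣ) {s : ℂ} (hs0 : s ≠ 0)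
    (hs1 : s ≠ 1) (hΓ : Complex.Gamma s ≠ 0) :
    classXi K ψ 1 * afeG (1 - s) / (1 - s) + classXi K ψ 0 * afeG s / s =
      -(afeR K ψ q s * dedekindGammaFactor K s) := by
  have hq : 0 < q := by
    rcases Nat.eq_zero_or_pos q with h | h
    · exfalso; exact NumberField.discr_ne_zero K (by rw [hdisc, h]; simp)
    · exact h
  have hQ0 : (condQ q : ℂ) ≠ 0 := by exact_mod_cast (condQ_pos hq).ne'
  have h1s : (1 : ℂ) - s ≠ 0 := sub_ne_zero.2 (Ne.symm hs1)
  by_cases hψ : ψ = 1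
  · subst hψ
    have hinv : (1 : ClassGroup (𝓞 K) →* ℂˣ)⁻¹ = 1 := MonoidHom.ext fun C ↦ by simp
    have hξ0 : classXi K 1 0 = classXi K 1 1 := by
      rw [classXi_zero, hinv, classRootNumber, MonoidHom.one_apply, Units.val_one, one_mul]
    rw [afeR, if_pos rfl, hξ0, classXi_one_one, dedekindGammaFactor_eq_condQ K h2 hdisc 1,
      dedekindGammaFactor_eq_condQ K h2 hdisc s, Complex.Gamma_one, Complex.cpow_one]
    have : (condQ q : ℂ) ^ (1 - s) = condQ q / (condQ q : ℂ) ^ s := by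
      rw [Complex.cpow_sub _ _ hQ0, Complex.cpow_one]
    rw [this]
    have hQs : (condQ q : ℂ) ^ s ≠ 0 := Complex.cpow_ne_zero_iff.2 (Or.inl hQ0)
    field_simp
  · obtain ⟨hξ1, hξ0⟩ := classXi_one_and_zero_of_ne_one (K := K) hψ
    rw [afeR, if_neg hψ, hξ1, hξ0]
    simp

/-- **Proposition 7.1 on `Re s = 1/2` (general form, dual sum explicit)**:
`L(s,ψ) = A_ψ(s) + W(ψ)·X(s)·A_{ψ⁻¹}(1−s) + R(s)` for `K = ℚ(√−q)` (`[K:ℚ] = 2`, `d_K = −q`), where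
`A_ψ(s) = Σ λ_ψ(n)n^{−s}V_s(n/Q)`, `X(s) = Q^{1−2s}Γ(1−s)/Γ(s)`, `W(ψ) = ψ([𝔡_K])`, `R = afeR`.
Proof: `(1/2πi)∫_{(1)} Λ(s+u)G(u)du/u` shifted to `Re u = −1` past the poles `0, 1−s, −s`, the
functional equation on the left line, and termwise integration of the Dirichlet series.
[cite: ConreyIwaniec2002, Proposition 7.1 (7.12)] -/
theorem classGroupLFunction_eq_afe {q : ℕ} (h2 : Module.finrank ℚ K = 2)
    (hdisc : NumberField.discr K = -(q : ℤ)) (ψ : ClassGroup (𝓞 K) →* ℂˣ) {s : ℂ} (hs : s.re = 1 / 2) :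
    classGroupLFunction K ψ s =
      afeA K ψ q s + classRootNumber K ψ * afeX q s * afeA K ψ⁻¹ q (1 - s) + afeR K ψ q s := by
  have hs0 : s ≠ 0 := fun h ↦ by rw [h, Complex.zero_re] at hs; norm_num at hs
  have hs1 : s ≠ 1 := fun h ↦ by rw [h, Complex.one_re] at hs; norm_num at hs
  have hspos : 0 < s.re := by rw [hs]; norm_num
  have h1spos : 0 < (1 - s).re := by simp [hs]; norm_num
  have hΓ : Complex.Gamma s ≠ 0 := Complex.Gamma_ne_zero_of_re_pos hspos
  have hγ : dedekindGammaFactor K s ≠ 0 := dedekindGammaFactor_ne_zero_of_re_pos hspos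
  have h2π : (2 * Real.pi : ℂ) ≠ 0 := by exact_mod_cast (by positivity : (2 : ℝ) * Real.pi ≠ 0)
  have E1 := integral_lineOne (K := K) h2 hdisc ψ hspos
  have E1' := integral_lineOne (K := K) h2 hdisc ψ⁻¹ h1spos
  have E3 := integral_afeF_lineNegOne (K := K) ψ s
  have E2 := integral_afeF_lineOne_sub_lineNegOne (K := K) ψ hs
  rw [E3, E1', E1] at E2
  have hξs : classXi K ψ s / (s * (s - 1)) = dedekindGammaFactor K s * classGroupLFunction K ψ s := by
    rw [classXi_eq_mul ψ hspos hs1, mul_div_cancel_left₀ _ (mul_ne_zero hs0 (sub_ne_zero.2 hs1))]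
  rw [hξs] at E2
  have key : dedekindGammaFactor K s * classGroupLFunction K ψ s =
      dedekindGammaFactor K s * afeA K ψ q s +
        classRootNumber K ψ * dedekindGammaFactor K (1 - s) * afeA K ψ⁻¹ q (1 - s) -
        (classXi K ψ 1 * afeG (1 - s) / (1 - s) + classXi K ψ 0 * afeG s / s) := by
    apply mul_left_cancel₀ h2π
    linear_combination (-1 : ℂ) * E2
  rw [residues_eq_neg_afeR_mul h2 hdisc ψ hs0 hs1 hΓ,
    dedekindGammaFactor_one_sub_eq_afeX_mul h2 hdisc hΓ] at key
  apply mul_left_cancel₀ hγ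
  rw [key]
  ring

/-- **Proposition 7.1 on the critical line, conjugate form**: for `s = ½ + it`,
`L(s,ψ) = A(s) + ψ([𝔡_K])·X(s)·conj A(s) + R(s)` (`A_{ψ⁻¹}(1−s) = A_{ψ⁻¹}(s̄) = conj A_ψ(s)`).
[cite: ConreyIwaniec2002, Proposition 7.1 (7.12)] -/
theorem classGroupLFunction_eq_afe_conj {q : ℕ} (h2 : Module.finrank ℚ K = 2)
    (hdisc : NumberField.discr K = -(q : ℤ)) (ψ : ClassGroup (𝓞 K) →* ℂˣ) (t : ℝ) :
    classGroupLFunction K ψ (1 / 2 + t * I) =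
      afeA K ψ q (1 / 2 + t * I) +
        (ψ (differentClass K) : ℂ) * afeX q (1 / 2 + t * I) *
          starRingEnd ℂ (afeA K ψ q (1 / 2 + t * I)) +
        afeR K ψ q (1 / 2 + t * I) := by
  have hs : (1 / 2 + t * I : ℂ).re = 1 / 2 := by simp
  have hconj : 1 - (1 / 2 + t * I : ℂ) = conj (1 / 2 + t * I) := by
    apply Complex.ext <;> norm_num
  rw [classGroupLFunction_eq_afe h2 hdisc ψ hs, hconj, afeA_inv_conj]
  rfl

/-- **Proposition 7.1 in the registered shape of the line `prop81-afe-plancherel`** (stub S1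
`stub_afe`, verbatim): for odd `q > 4`, `K` with `[K:ℚ] = 2`, `d_K = −q`, every class group character
`ψ` and every `t ≠ 0`, `L(½+it,ψ) = A(½+it) + ψ([𝔡_K])·X(½+it)·conj A(½+it) + R(½+it)`. (The
hypotheses `4 < q`, `Odd q`, `t ≠ 0` are not used.) [cite: ConreyIwaniec2002, Proposition 7.1 (7.12)] -/
theorem classGroupLFunction_eq_afe_all :
    ∀ (q : ℕ) [NeZero q], 4 < q → Odd q →
      ∀ (K : Type) [Field K] [NumberField K],
        Module.finrank ℚ K = 2 → NumberField.discr K = -(q : ℤ) →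
          ∀ (ψ : ClassGroup (𝓞 K) →* ℂˣ) (t : ℝ), t ≠ 0 →
            classGroupLFunction K ψ (1 / 2 + t * I) =
              afeA K ψ q (1 / 2 + t * I) +
                (ψ (differentClass K) : ℂ) * afeX q (1 / 2 + t * I) *
                  starRingEnd ℂ (afeA K ψ q (1 / 2 + t * I)) +
                afeR K ψ q (1 / 2 + t * I) :=
  fun _ _ _ _ K _ _ h2 hdisc ψ t _ ↦ classGroupLFunction_eq_afe_conj (K := K) h2 hdisc ψ t

end ConreyIwaniec2002

end Literature.NumberTheory.LFunctions

end
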